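import Summits.Parity.GeneralizedHardyLittlewood.Theorems.FordMaynardNoSieveConst0164NegWitness0164LogKernel
import Literature.NumberTheory.Sieve.FordMaynardSliceBlocks
import Literature.NumberTheory.Sieve.FordMaynardSieveBoundG1
import HarnessLib

/-!
# Route `FordMaynardSieveConst01651`, target `SieveConst01651` (stmt-Parity-19185), line `sieve_decomposition`,
# stub `stub_coneCertClosed`: convolution bricks for the certificate value `V(ν, g) = sieveBoundG1 ν g`

Helper file (def-free) toward the certificate stub (K. Ford, J. Maynard, *On the theory of prime producing
sieves*, arXiv:2407.14368, Theorem 7.3 (a), §8.2).  The last conjunct of `stub_coneCertClosed` is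
`0 < sieveBoundG1 ν₀ g₀`, a sum over `k = 2, …, 6` of `k`-dimensional slice integrals of `(𝟙⋆g)(x)/(x₁⋯x_k)`.
After symmetrisation, every summand `g_{|A|}(x_A)/∏ xᵢ` of `(𝟙⋆g)(x)/∏ xᵢ` is a PRODUCT of a function of the block
`x_A` and of `1/∏_{i ∉ A} xᵢ`; the bricks below turn each such slice integral into a ONE-dimensional integral of
the block's own slice function against the universal kernels
`F_m(s) = ∫_{u ∈ (ν,∞)^m, |u| = s} du/(u₁⋯u_m)` (`m` free coordinates), and give `F₂` in closed form:

* `kernelTwo_eq_log` — `F₂(s) = (log((s−ν)/ν) − log(ν/(s−ν)))/s` (`= (2/s)·log((s−ν)/ν)`) for `2ν < s`,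
  and `kernelTwo_eq_zero` — `F₂(s) = 0` for `s ≤ 2ν` (general `ν > 0`; the tree had this only at `ν = 41/250`);
* `sliceIntegral_box_split` — **two-block product split**: for bounded measurable `Ψ` on the first block,
  `∫_{|z| = w} 𝟙[zᵢ > ν ∀ i]·Ψ(z_{first block})/∏ zᵢ = ∫_{t ∈ (0,w]} S_Ψ(t) · F_{b+1}(w − t) dt` with
  `S_Ψ(t) = ∫_{|v| = t} 𝟙[vᵢ > ν]·Ψ(v)/∏ vᵢ` (from the tree's `sliceIntegral_append`).

References: [FordMaynard2024PrimeSieves] arXiv:2407.14368, Theorem 7.3 (a) (the integrals `∫ (𝟙⋆g)(x)/(x₁⋯x_k)`),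
§8.2 (the kernels `F₃ = F₄`), §4.2 (normalisation of slice integrals).
-/

noncomputable section

open MeasureTheory Set Finset
open scoped Classical
open Literature.NumberTheory.Sieve Literature.NumberTheory.Sieve.FordMaynard
open Summit.Parity.GeneralizedHardyLittlewood.FordMaynardNoSieveConst0164NegWitness0164

namespace Summit.Parity.GeneralizedHardyLittlewood.FordMaynardSieveConst01651SieveConst01651

/-! ### The two-dimensional kernel `F₂` in closed form (general `ν`) -/

/-- **`F₂(s)` in closed form.** For `0 < ν` and `2ν < s`,
`∫_{u ∈ (0,∞)², u₁+u₂ = s} 𝟙[uᵢ > ν ∀ i]/(u₁u₂) du = (log((s−ν)/ν) − log(ν/(s−ν)))/s` (on the slice the box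
`uᵢ > ν` is the window `ν < u₁ < s − ν`). [cite: FordMaynard2024PrimeSieves, §8.2 (F₃ = F₄ = log(α/ν − 1), case α < 1/2 + ν)] -/
theorem kernelTwo_eq_log {ν s : ℝ} (hν : 0 < ν) (hs : 2 * ν < s) :
    sliceIntegral 2 s (fun u => if ∀ i, ν < u i then 1 / ∏ i, u i else 0) =
      (Real.log ((s - ν) / (s - (s - ν))) - Real.log (ν / (s - ν))) / s := by
  rw [← kernel_two_window_eq_log hν (by linarith) (by linarith)]
  refine sliceIntegral_congr fun v _ hvs => ?_
  rw [Fin.sum_univ_two] at hvs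
  rw [Fin.prod_univ_two]
  have hiff : (∀ i, ν < v i) ↔ (ν < v 0 ∧ v 0 < s - ν) := by
    simp only [Fin.forall_fin_two]
    constructor
    · rintro ⟨h0, h1⟩; exact ⟨h0, by linarith⟩
    · rintro ⟨h0, h1⟩; exact ⟨h0, by linarith⟩
  simp only [hiff]

/-- **`F₂(s) = 0` below the threshold**: for `s ≤ 2ν` the box `uᵢ > ν` misses the slice `u₁ + u₂ = s`.
[cite: FordMaynard2024PrimeSieves, §8.2 (F₃ = F₄)] -/
theorem kernelTwo_eq_zero {ν s : ℝ} (hs : s ≤ 2 * ν) :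
    sliceIntegral 2 s (fun u => if ∀ i, ν < u i then 1 / ∏ i, u i else 0) = 0 := by
  have h : sliceIntegral 2 s (fun u => if ∀ i, ν < u i then 1 / ∏ i, u i else 0) =
      sliceIntegral 2 s (fun _ => 0) := by
    refine sliceIntegral_congr fun v _ hvs => ?_
    rw [Fin.sum_univ_two] at hvs
    have : ¬ (∀ i, ν < v i) := by
      intro h
      have h0 := h 0; have h1 := h 1
      linarith
    rw [if_neg this]
  rw [h, sliceIntegral_zero]

/-! ### The general kernel `F_m` vanishes below `mν` and the box integrand is bounded -/

/-- On the box `uᵢ > ν` (`ν > 0`) in dimension `m`, `∏ uᵢ ≥ ν^m`, so `|c/∏ uᵢ| ≤ |c|/ν^m`. [folklore] -/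
theorem abs_div_prod_le_of_box {m : ℕ} {ν : ℝ} (hν : 0 < ν) {u : Fin m → ℝ} (hu : ∀ i, ν < u i) (c : ℝ) :
    |c / ∏ i, u i| ≤ |c| / ν ^ m := by
  have hprod : ν ^ m ≤ ∏ i, u i := by
    calc ν ^ m = ∏ _i : Fin m, ν := by simp
      _ ≤ ∏ i, u i := Finset.prod_le_prod (fun i _ => hν.le) (fun i _ => (hu i).le)
  have hpos : 0 < ∏ i, u i := lt_of_lt_of_le (pow_pos hν m) hprod
  rw [abs_div, abs_of_pos hpos]
  exact div_le_div_of_nonneg_left (abs_nonneg c) (pow_pos hν m) hprod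

/-- **`F_m(s) = 0` for `s ≤ mν`** (`m ≥ 1`): the box `uᵢ > ν` misses the slice `|u| = s`. [folklore] -/
theorem kernel_eq_zero_of_le {m : ℕ} (hm : 1 ≤ m) {ν s : ℝ} (hs : s ≤ m * ν) :
    sliceIntegral m s (fun u => if ∀ i, ν < u i then 1 / ∏ i, u i else 0) = 0 := by
  have h : sliceIntegral m s (fun u => if ∀ i, ν < u i then 1 / ∏ i, u i else 0) =
      sliceIntegral m s (fun _ => 0) := by
    refine sliceIntegral_congr fun v _ hvs => ?_
    have : ¬ (∀ i, ν < v i) := by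
      intro h
      have hlt : (m : ℝ) * ν < ∑ i, v i := by
        calc (m : ℝ) * ν = ∑ _i : Fin m, ν := by simp
          _ < ∑ i, v i := by
            refine Finset.sum_lt_sum_of_nonempty ?_ (fun i _ => h i)
            rw [Finset.univ_nonempty_iff]
            exact ⟨⟨0, hm⟩⟩
      linarith
    rw [if_neg this]
  rw [h, sliceIntegral_zero]

/-! ### Two-block product split -/

/-- The box condition on an appended vector splits into the two blocks. [folklore] -/
theorem forall_lt_append_iff {a b : ℕ} (ν : ℝ) (v : Fin a → ℝ) (u : Fin b → ℝ) :
    (∀ i, ν < Fin.append v u i) ↔ (∀ i, ν < v i) ∧ ∀ j, ν < u j := by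
  constructor
  · intro h
    refine ⟨fun i => ?_, fun j => ?_⟩
    · simpa using h (Fin.castAdd b i)
    · simpa using h (Fin.natAdd a j)
  · rintro ⟨hv, hu⟩ i
    refine Fin.addCases (fun i => ?_) (fun j => ?_) i
    · simpa using hv i
    · simpa using hu j

/-- The product over an appended vector is the product of the block products. [folklore] -/
theorem prod_append {a b : ℕ} (v : Fin a → ℝ) (u : Fin b → ℝ) :
    ∏ i, Fin.append v u i = (∏ i, v i) * ∏ j, u j := by
  rw [Fin.prod_univ_add]
  simp

/-- **Two-block product split of a box slice integral.** For `ν > 0`, blocks of sizes `a+1` (first) and `b+1`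
(second), and a bounded measurable function `Ψ` of the first block:
`∫_{z ∈ (0,∞)^{(a+1)+(b+1)}, |z| = w} 𝟙[zᵢ > ν ∀ i] Ψ(z_{first})/∏ zᵢ dz
   = ∫_{t ∈ (0, w]} (∫_{|v| = t} 𝟙[vᵢ > ν] Ψ(v)/∏ vᵢ dv) · (∫_{|u| = w−t} 𝟙[uⱼ > ν]/∏ uⱼ du) dt`
— the second factor is the universal kernel `F_{b+1}(w − t)`.  (Tree: `sliceIntegral_append`, two-block Fubini for
bounded measurable integrands; the box makes the integrand bounded by `sup|Ψ|/ν^{a+b+2}`.)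
[cite: FordMaynard2024PrimeSieves, Theorem 7.3 (a) with §4.2 (Notational convention)] -/
theorem sliceIntegral_box_split (a b : ℕ) {ν : ℝ} (hν : 0 < ν) (w : ℝ)
    (Ψ : (Fin (a + 1) → ℝ) → ℝ) (hΨm : Measurable Ψ) {C : ℝ} (hC : 0 ≤ C) (hΨb : ∀ v, |Ψ v| ≤ C) :
    sliceIntegral (a + 1 + (b + 1)) w
        (fun z => if ∀ i, ν < z i then Ψ (fun i => z (Fin.castAdd (b + 1) i)) / ∏ i, z i else 0) =
      ∫ t in Set.Ioc 0 w,
        sliceIntegral (a + 1) t (fun v => if ∀ i, ν < v i then Ψ v / ∏ i, v i else 0) *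
          sliceIntegral (b + 1) (w - t) (fun u => if ∀ i, ν < u i then 1 / ∏ i, u i else 0) := by
  set G : (Fin (a + 1 + (b + 1)) → ℝ) → ℝ :=
    fun z => if ∀ i, ν < z i then Ψ (fun i => z (Fin.castAdd (b + 1) i)) / ∏ i, z i else 0 with hGdef
  -- measurability
  have hGm : Measurable G := by
    refine Measurable.ite ?_ ?_ measurable_const
    · have : {z : Fin (a + 1 + (b + 1)) → ℝ | ∀ i, ν < z i} = ⋂ i, (fun z => z i) ⁻¹' Set.Ioi ν := by
        ext z; simp
      rw [this]
      exact MeasurableSet.iInter fun i => measurable_pi_apply i measurableSet_Ioi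
    · refine (hΨm.comp ?_).div (Finset.measurable_prod _ fun i _ => measurable_pi_apply i)
      exact measurable_pi_lambda _ fun i => measurable_pi_apply _
  -- boundedness by `C / ν^(a+1+(b+1))`
  have hGb : ∀ z, |G z| ≤ C / ν ^ (a + 1 + (b + 1)) := by
    intro z
    simp only [hGdef]
    split_ifs with hz
    · refine (abs_div_prod_le_of_box hν hz _).trans ?_
      exact div_le_div_of_nonneg_right (hΨb _) (pow_pos hν _).le
    · rw [abs_zero]; positivity
  rw [sliceIntegral_append a b w G hGm (by positivity) hGb]
  refine setIntegral_congr_fun measurableSet_Ioc fun t _ => ?_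
  -- pointwise in `t`: factor the appended integrand
  have hsplit : ∀ (v : Fin (a + 1) → ℝ) (u : Fin (b + 1) → ℝ), G (Fin.append v u) =
      (if ∀ i, ν < v i then Ψ v / ∏ i, v i else 0) * (if ∀ i, ν < u i then 1 / ∏ i, u i else 0) := by
    intro v u
    have hG : G (Fin.append v u) =
        if (∀ i, ν < v i) ∧ ∀ j, ν < u j then Ψ v / ((∏ i, v i) * ∏ j, u j) else 0 := by
      simp only [hGdef, forall_lt_append_iff, Fin.append_left, prod_append]
    rw [hG]
    by_cases hv : ∀ i, ν < v i
    · by_cases hu : ∀ j, ν < u j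
      · rw [if_pos ⟨hv, hu⟩, if_pos hv, if_pos hu, div_mul_div_comm, mul_one]
      · rw [if_neg (fun h => hu h.2), if_neg hu, mul_zero]
    · rw [if_neg (fun h => hv h.1), if_neg hv, zero_mul]
  have hinner : ∀ v : Fin (a + 1) → ℝ,
      sliceIntegral (b + 1) (w - t) (fun u => G (Fin.append v u)) =
        (if ∀ i, ν < v i then Ψ v / ∏ i, v i else 0) *
          sliceIntegral (b + 1) (w - t) (fun u => if ∀ i, ν < u i then 1 / ∏ i, u i else 0) := by
    intro v
    simp only [hsplit]
    rw [sliceIntegral_const_mul]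
  simp only [hinner]
  rw [show (fun v : Fin (a + 1) → ℝ => (if ∀ i, ν < v i then Ψ v / ∏ i, v i else 0) *
      sliceIntegral (b + 1) (w - t) (fun u => if ∀ i, ν < u i then 1 / ∏ i, u i else 0)) =
      fun v => sliceIntegral (b + 1) (w - t) (fun u => if ∀ i, ν < u i then 1 / ∏ i, u i else 0) *
        (if ∀ i, ν < v i then Ψ v / ∏ i, v i else 0) from funext fun v => mul_comm _ _]
  rw [sliceIntegral_const_mul, mul_comm]

/-! ### The kernels `F_m`: `F₁` and the recursion `F_{m+1} = F₁ ∗ F_m` -/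

/-- **`F₁(s) = 𝟙[s > ν]/s`** (`ν > 0`): in dimension one the slice is the point `u₁ = s`. [folklore] -/
theorem kernel_one {ν : ℝ} (hν : 0 < ν) (s : ℝ) :
    sliceIntegral 1 s (fun u => if ∀ i, ν < u i then 1 / ∏ i, u i else 0) = if ν < s then 1 / s else 0 := by
  rw [sliceIntegral_one]
  by_cases hs : ν < s
  · rw [if_pos (hν.trans hs), if_pos hs, if_pos (fun _ => hs)]
    simp
  · rw [if_neg hs]
    by_cases h0 : 0 < s
    · rw [if_pos h0, if_neg (fun h => hs (h 0))]
    · rw [if_neg h0]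

/-- **Kernel recursion `F_{m+1}(s) = ∫_{t ∈ (0,s]} (𝟙[t > ν]/t) · F_m(s − t) dt`** for `m ≥ 1`, `ν > 0`
(the two-block split with a one-dimensional first block and `Ψ ≡ 1`). [folklore] -/
theorem kernel_succ {m : ℕ} (hm : 1 ≤ m) {ν : ℝ} (hν : 0 < ν) (s : ℝ) :
    sliceIntegral (m + 1) s (fun u => if ∀ i, ν < u i then 1 / ∏ i, u i else 0) =
      ∫ t in Set.Ioc 0 s, (if ν < t then 1 / t else 0) *
        sliceIntegral m (s - t) (fun u => if ∀ i, ν < u i then 1 / ∏ i, u i else 0) := by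
  obtain ⟨b, rfl⟩ : ∃ b, m = b + 1 := ⟨m - 1, by omega⟩
  have hsplit := sliceIntegral_box_split 0 b hν s (fun _ => (1 : ℝ)) measurable_const zero_le_one
    (fun _ => by simp)
  -- relabel `0 + 1 + (b + 1) = b + 1 + 1`
  have hc : 0 + 1 + (b + 1) = b + 1 + 1 := by omega
  have hcast : sliceIntegral (b + 1 + 1) s (fun u => if ∀ i, ν < u i then 1 / ∏ i, u i else 0) =
      sliceIntegral (0 + 1 + (b + 1)) s
        (fun z => if ∀ i, ν < z i then (fun _ : Fin (0 + 1) → ℝ => (1 : ℝ))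
          (fun i => z (Fin.castAdd (b + 1) i)) / ∏ i, z i else 0) := by
    rw [← sliceIntegral_comp_cast hc s]
    refine sliceIntegral_congr fun v _ _ => ?_
    have hiff : (∀ i, ν < (v ∘ Fin.cast hc) i) ↔ ∀ i, ν < v i := by
      constructor
      · intro h i
        have hi : Fin.cast hc (Fin.cast hc.symm i) = i := Fin.ext rfl
        have := h (Fin.cast hc.symm i)
        rw [Function.comp_apply, hi] at this
        exact this
      · intro h i
        exact h _
    have hprod : ∏ i, (v ∘ Fin.cast hc) i = ∏ i, v i :=
      Fintype.prod_equiv (finCongr hc) _ _ (fun _ => rfl)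
    simp only [hiff, hprod]
  rw [hcast, hsplit]
  refine setIntegral_congr_fun measurableSet_Ioc fun t _ => ?_
  rw [kernel_one hν t]

/-- **One distinguished coordinate**: for `ν > 0`, a bounded measurable `φ : ℝ → ℝ` and `b + 1` free coordinates,
`∫_{|z| = w} 𝟙[zᵢ > ν ∀ i] φ(z₀)/∏ zᵢ dz = ∫_{t ∈ (0,w]} (𝟙[t > ν] φ(t)/t) · F_{b+1}(w − t) dt` — the shape of the
`|A| = 1` summands `g₁(x_i)/∏ x` of `(𝟙⋆g)(x)/∏ x` in Theorem 7.3 (a): a single integral of the one-dimensional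
cone data against the kernel. [cite: FordMaynard2024PrimeSieves, Theorem 7.3 (a) with §4.2 (Notational convention)] -/
theorem sliceIntegral_box_split_one (b : ℕ) {ν : ℝ} (hν : 0 < ν) (w : ℝ) (φ : ℝ → ℝ) (hφm : Measurable φ)
    {C : ℝ} (hC : 0 ≤ C) (hφb : ∀ t, |φ t| ≤ C) :
    sliceIntegral (1 + (b + 1)) w
        (fun z => if ∀ i, ν < z i then φ (z (Fin.castAdd (b + 1) 0)) / ∏ i, z i else 0) =
      ∫ t in Set.Ioc 0 w, (if ν < t then φ t / t else 0) *
        sliceIntegral (b + 1) (w - t) (fun u => if ∀ i, ν < u i then 1 / ∏ i, u i else 0) := by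
  have hsplit := sliceIntegral_box_split 0 b hν w (fun v : Fin (0 + 1) → ℝ => φ (v 0))
    (hφm.comp (measurable_pi_apply 0)) hC (fun v => hφb (v 0))
  rw [show (fun z : Fin (1 + (b + 1)) → ℝ =>
      if ∀ i, ν < z i then φ (z (Fin.castAdd (b + 1) 0)) / ∏ i, z i else 0) =
      fun z => if ∀ i, ν < z i then (fun v : Fin (0 + 1) → ℝ => φ (v 0))
        (fun i => z (Fin.castAdd (b + 1) i)) / ∏ i, z i else 0 from rfl]
  rw [hsplit]
  refine setIntegral_congr_fun measurableSet_Ioc fun t _ => ?_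
  congr 1
  rw [sliceIntegral_one]
  by_cases ht : ν < t
  · rw [if_pos (hν.trans ht), if_pos ht, if_pos (fun _ => ht)]
    simp
  · rw [if_neg ht]
    by_cases h0 : 0 < t
    · rw [if_pos h0, if_neg (fun h => ht (h 0))]
    · rw [if_neg h0]

end Summit.Parity.GeneralizedHardyLittlewood.FordMaynardSieveConst01651SieveConst01651

end
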